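import Literature.Analysis.Calculus.WhitneyEvenFunction
import Literature.Analysis.Calculus.SeeleyExtension
import Mathlib.Analysis.Calculus.BumpFunction.FiniteDimension
import Mathlib.Analysis.SpecialFunctions.SmoothTransition
import HarnessLib

/-!
# Whitney's theorem on even functions: several variables, parameters, full neighbourhood

H. Whitney, *Differentiable even functions*, Duke Math. J. 10 (1943) 159–160, Thm. 1 and the
Remark following it (several variables): a `C^∞` function `F (ρ₁, …, ρ_k, z)` which is even in EACH
`ρ_i` separately is `U (ρ₁², …, ρ_k², z)` for a `C^∞` function `U` of `(s, z)` on the WHOLE space.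

The tree already has the one-variable theorem with parameters on the closed half-space
(★ `contDiffOn_comp_sqrt_of_even`: `(s, z) ↦ F (√s, z)` is `C^∞` on `{s ≥ 0}` within) and Seeley's
extension across a hyperplane (★ `Seeley.contDiffOn_extend`).  Here:

* `Seeley.extend_apply_eq_of_forall` — Seeley's operator acts on the normal variable only, so any
  symmetry of `f` in the parameter is inherited by the extension;
* `Seeley.contDiff_extend_of_contDiffOn_Ici` — a function `C^∞` on the closed half-space
  `{s ≥ 0} × E'` (within) has a `C^∞` extension to the whole space (`δ = 1`, `B = univ`);
* `exists_contDiff_comp_sq_of_forall_even` — the several-variables theorem: induction on `k`,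
  one coordinate at a time (Whitney in `ρ₀` with parameter `(ρ', z)`, Seeley across `s₀ = 0` — the
  extension is again even in every `ρ'_i` by the first bullet — then the induction hypothesis with
  parameter `(s₀, z)`); the values on the closed orthant are forced: `U (s, z) = F (√s, z)`.

This is the «orthant Whitney step at a `k`-fold point, one place at a time, extension between the
iterations» of the wall road for the archimedean stable orbital integrals (class functions at a
central block), as pure calculus.

## References

* H. Whitney, *Differentiable even functions*, Duke Math. J. 10 (1943), 159–160. [folklore]
* R. T. Seeley, *Extension of `C^∞` functions defined in a half space*, Proc. AMS 15 (1964),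
  625–626. [Seeley1964]
-/

noncomputable section

open Set Function Filter
open scoped Topology ContDiff

namespace Literature.Analysis.Calculus

universe u

section SeeleyParam

variable {E' F : Type*} [NormedAddCommGroup E'] [NormedSpace ℝ E'] [NormedAddCommGroup F]
  [NormedSpace ℝ F]

/-- **Seeley's operator acts on the normal variable only**: if `f (t, x') = f (t, x)` for all
heights `t`, then `E f (t, x') = E f (t, x)` — every symmetry of `f` in the parameter is inherited
by the extension. [cite: Seeley1964, Theorem] -/
theorem Seeley.extend_apply_eq_of_forall (δ : ℝ) (f : ℝ × E' → F) {x x' : E'}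
    (h : ∀ t : ℝ, f (t, x') = f (t, x)) (t : ℝ) :
    Seeley.extend δ f (t, x') = Seeley.extend δ f (t, x) := by
  by_cases ht : 0 ≤ t
  · rw [Seeley.extend_of_nonneg (p := (t, x')) ht, Seeley.extend_of_nonneg (p := (t, x)) ht, h]
  · rw [not_le] at ht
    rw [Seeley.extend_of_neg (p := (t, x')) ht, Seeley.extend_of_neg (p := (t, x)) ht]
    refine tsum_congr fun k => ?_
    simp only [Seeley.term, Seeley.scale_apply, h]

/-- **A function `C^∞` on a closed half-space (within) has a `C^∞` extension to the whole space**: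
Seeley's extension with `δ = 1` over the whole hyperplane is smooth everywhere (below height `1` by
★ `Seeley.contDiffOn_extend`, above height `0` because it IS `f` there). [cite: Seeley1964, Theorem] -/
theorem Seeley.contDiff_extend_of_contDiffOn_Ici [CompleteSpace F] {g : ℝ × E' → F}
    (hg : ContDiffOn ℝ ∞ g (Ici 0 ×ˢ univ)) : ContDiff ℝ ∞ (Seeley.extend 1 g) := by
  have hslab : Seeley.slab (1 : ℝ) (univ : Set E') ⊆ Ici 0 ×ˢ univ := fun p hp =>
    ⟨(show p.1 ∈ Ico (0 : ℝ) 1 from hp.1).1, mem_univ _⟩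
  have h1 : ContDiffOn ℝ ∞ (Seeley.extend 1 g) (Iio 1 ×ˢ univ) :=
    Seeley.contDiffOn_extend one_pos isOpen_univ (hg.mono hslab)
  refine contDiff_iff_contDiffAt.2 fun p => ?_
  by_cases hp : p.1 < 1
  · exact h1.contDiffAt ((isOpen_Iio.prod isOpen_univ).mem_nhds ⟨hp, mem_univ _⟩)
  · have hp0 : 0 < p.1 := lt_of_lt_of_le one_pos (not_lt.1 hp)
    have hmem : Ioi (0 : ℝ) ×ˢ (univ : Set E') ∈ 𝓝 p :=
      (isOpen_Ioi.prod isOpen_univ).mem_nhds ⟨hp0, mem_univ _⟩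
    have hga : ContDiffAt ℝ ∞ g p :=
      hg.contDiffAt (mem_of_superset hmem (prod_mono Ioi_subset_Ici_self subset_rfl))
    refine hga.congr_of_eventuallyEq ?_
    filter_upwards [hmem] with q hq
    exact Seeley.extend_of_nonneg (le_of_lt hq.1)

end SeeleyParam

section Several

/-- Induction carrier for `exists_contDiff_comp_sq_of_forall_even` (all parameter spaces at once).
[folklore] -/
private theorem exists_contDiff_comp_sq_aux : ∀ (k : ℕ) {P : Type u} [NormedAddCommGroup P]
    [NormedSpace ℝ P] [FiniteDimensional ℝ P] {E : Type u} [NormedAddCommGroup E] [NormedSpace ℝ E]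
    [CompleteSpace E] (F : (Fin k → ℝ) × P → E), ContDiff ℝ ∞ F →
    (∀ (i : Fin k) (ρ : Fin k → ℝ) (z : P), F (update ρ i (-ρ i), z) = F (ρ, z)) →
    ∃ U : (Fin k → ℝ) × P → E, ContDiff ℝ ∞ U ∧
      ∀ (ρ : Fin k → ℝ) (z : P), F (ρ, z) = U (fun i => ρ i ^ 2, z) := by
  intro k
  induction k with
  | zero =>
    intro P _ _ _ E _ _ _ F hF _
    exact ⟨F, hF, fun ρ z => by rw [Subsingleton.elim (fun i => ρ i ^ 2) ρ]⟩
  | succ k ih =>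
    intro P _ _ _ E _ _ _ F hF heven
    -- (1) split off the first coordinate: `F₁ (t, (ρ', z)) = F (t ∷ ρ', z)`
    let J : ℝ × ((Fin k → ℝ) × P) → (Fin (k + 1) → ℝ) × P := fun p => (Fin.cons p.1 p.2.1, p.2.2)
    have hJ : ContDiff ℝ ∞ J := by
      refine ContDiff.prodMk (contDiff_pi.2 fun i => ?_) (contDiff_snd.comp contDiff_snd)
      refine Fin.cases ?_ (fun j => ?_) i
      · simpa only [Fin.cons_zero] using (contDiff_fst : ContDiff ℝ ∞ fun p : ℝ × ((Fin k → ℝ) × P) => p.1)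
      · simp only [Fin.cons_succ]
        exact (contDiff_apply ℝ ℝ j).comp (contDiff_fst.comp contDiff_snd)
    let F₁ : ℝ × ((Fin k → ℝ) × P) → E := fun p => F (J p)
    have hF₁ : ContDiff ℝ ∞ F₁ := hF.comp hJ
    have hF₁even : ∀ (t : ℝ) (w : (Fin k → ℝ) × P), F₁ (-t, w) = F₁ (t, w) := by
      intro t w
      have h := heven 0 (Fin.cons t w.1) w.2
      rw [Fin.cons_zero, Fin.update_cons_zero] at h
      exact h
    have hF₁even' : ∀ (i : Fin k) (t : ℝ) (ρ' : Fin k → ℝ) (z : P),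
        F₁ (t, (update ρ' i (-ρ' i), z)) = F₁ (t, (ρ', z)) := by
      intro i t ρ' z
      have h := heven i.succ (Fin.cons t ρ') z
      rw [Fin.cons_succ, ← Fin.cons_update] at h
      exact h
    -- (2) Whitney in the first variable (half-space), Seeley across `s = 0`
    let G₁ : ℝ × ((Fin k → ℝ) × P) → E := fun p => F₁ (Real.sqrt p.1, p.2)
    have hG₁ : ContDiffOn ℝ ∞ G₁ (Ici 0 ×ˢ univ) := contDiffOn_comp_sqrt_of_even hF₁ hF₁even
    let U₁ : ℝ × ((Fin k → ℝ) × P) → E := Seeley.extend 1 G₁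
    have hU₁ : ContDiff ℝ ∞ U₁ := Seeley.contDiff_extend_of_contDiffOn_Ici hG₁
    have hU₁F : ∀ (t : ℝ) (w : (Fin k → ℝ) × P), F₁ (t, w) = U₁ (t ^ 2, w) := by
      intro t w
      have h0 : (0 : ℝ) ≤ (t ^ 2, w).1 := sq_nonneg t
      rw [show U₁ (t ^ 2, w) = G₁ (t ^ 2, w) from Seeley.extend_of_nonneg h0]
      show F₁ (t, w) = F₁ (Real.sqrt (t ^ 2), w)
      rw [Real.sqrt_sq_eq_abs]
      rcases abs_choice t with h | h
      · rw [h]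
      · rw [h, hF₁even]
    have hU₁even : ∀ (i : Fin k) (s : ℝ) (ρ' : Fin k → ℝ) (z : P),
        U₁ (s, (update ρ' i (-ρ' i), z)) = U₁ (s, (ρ', z)) := fun i s ρ' z =>
      Seeley.extend_apply_eq_of_forall 1 G₁ (fun t => hF₁even' i (Real.sqrt t) ρ' z) s
    -- (3) recurse on the remaining coordinates, with parameter `(s, z) ∈ ℝ × P`
    let F₂ : (Fin k → ℝ) × (ℝ × P) → E := fun p => U₁ (p.2.1, (p.1, p.2.2))
    have hF₂ : ContDiff ℝ ∞ F₂ :=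
      hU₁.comp (contDiff_snd.fst.prodMk (contDiff_fst.prodMk contDiff_snd.snd))
    have hF₂even : ∀ (i : Fin k) (ρ' : Fin k → ℝ) (w : ℝ × P),
        F₂ (update ρ' i (-ρ' i), w) = F₂ (ρ', w) := fun i ρ' w => hU₁even i w.1 ρ' w.2
    obtain ⟨U₂, hU₂, hU₂F⟩ := ih F₂ hF₂ hF₂even
    refine ⟨fun p => U₂ (Fin.tail p.1, (p.1 0, p.2)), ?_, fun ρ z => ?_⟩
    · refine hU₂.comp (ContDiff.prodMk ?_ (((contDiff_apply ℝ ℝ 0).comp contDiff_fst).prodMk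
        contDiff_snd))
      exact contDiff_pi.2 fun j => (contDiff_apply ℝ ℝ j.succ).comp contDiff_fst
    · calc F (ρ, z) = F₁ (ρ 0, (Fin.tail ρ, z)) := by
            show F (ρ, z) = F (Fin.cons (ρ 0) (Fin.tail ρ), z)
            rw [Fin.cons_self_tail]
        _ = U₁ ((ρ 0) ^ 2, (Fin.tail ρ, z)) := hU₁F _ _
        _ = F₂ (Fin.tail ρ, ((ρ 0) ^ 2, z)) := rfl
        _ = U₂ (fun j => Fin.tail ρ j ^ 2, ((ρ 0) ^ 2, z)) := hU₂F _ _
        _ = U₂ (Fin.tail (fun i => ρ i ^ 2), ((fun i => ρ i ^ 2) 0, z)) := rfl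

variable {P : Type u} [NormedAddCommGroup P] [NormedSpace ℝ P] [FiniteDimensional ℝ P]
  {E : Type u} [NormedAddCommGroup E] [NormedSpace ℝ E] [CompleteSpace E]

/-- **Whitney's theorem on even functions — several variables, with parameters, on the whole
space** (Whitney 1943, Thm. 1 and Remark): if `F : (Fin k → ℝ) × P → E` is `C^∞` and even in each
of the `k` real variables separately, then `F (ρ, z) = U (ρ₁², …, ρ_k², z)` for a `C^∞` function
`U` on ALL of `(Fin k → ℝ) × P`; on the closed orthant `U` is forced: `U (s, z) = F (√s, z)`.
[folklore] [cite: Seeley1964, Theorem] -/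
theorem exists_contDiff_comp_sq_of_forall_even {k : ℕ} (F : (Fin k → ℝ) × P → E)
    (hF : ContDiff ℝ ∞ F)
    (heven : ∀ (i : Fin k) (ρ : Fin k → ℝ) (z : P), F (update ρ i (-ρ i), z) = F (ρ, z)) :
    ∃ U : (Fin k → ℝ) × P → E, ContDiff ℝ ∞ U ∧
      (∀ (ρ : Fin k → ℝ) (z : P), F (ρ, z) = U (fun i => ρ i ^ 2, z)) ∧
      ∀ (s : Fin k → ℝ) (z : P), (∀ i, 0 ≤ s i) → U (s, z) = F (fun i => Real.sqrt (s i), z) := by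
  obtain ⟨U, hU, hUF⟩ := exists_contDiff_comp_sq_aux k F hF heven
  refine ⟨U, hU, hUF, fun s z hs => ?_⟩
  rw [hUF]
  congr 2
  funext i
  exact (Real.sq_sqrt (hs i)).symm

/-- **Whitney's theorem on even functions — any finite index type.** The several-variables
theorem transported along `Fintype.equivFin`. [folklore] [cite: Seeley1964, Theorem] -/
theorem exists_contDiff_comp_sq_of_forall_even_fintype {ι : Type*} [Fintype ι] [DecidableEq ι]
    (F : (ι → ℝ) × P → E) (hF : ContDiff ℝ ∞ F)
    (heven : ∀ (i : ι) (ρ : ι → ℝ) (z : P), F (update ρ i (-ρ i), z) = F (ρ, z)) :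
    ∃ U : (ι → ℝ) × P → E, ContDiff ℝ ∞ U ∧
      (∀ (ρ : ι → ℝ) (z : P), F (ρ, z) = U (fun i => ρ i ^ 2, z)) ∧
      ∀ (s : ι → ℝ) (z : P), (∀ i, 0 ≤ s i) → U (s, z) = F (fun i => Real.sqrt (s i), z) := by
  let e := Fintype.equivFin ι
  let F' : (Fin (Fintype.card ι) → ℝ) × P → E := fun p => F (fun i => p.1 (e i), p.2)
  have hF' : ContDiff ℝ ∞ F' :=
    hF.comp ((contDiff_pi.2 fun i => (contDiff_apply ℝ ℝ (e i)).comp contDiff_fst).prodMk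
      contDiff_snd)
  have heven' : ∀ (j : Fin (Fintype.card ι)) (ρ' : Fin (Fintype.card ι) → ℝ) (z : P),
      F' (update ρ' j (-ρ' j), z) = F' (ρ', z) := by
    intro j ρ' z
    have h := heven (e.symm j) (fun i => ρ' (e i)) z
    have hfun : (fun i => update ρ' j (-ρ' j) (e i)) =
        update (fun i => ρ' (e i)) (e.symm j) (-(fun i => ρ' (e i)) (e.symm j)) := by
      funext i
      by_cases hi : i = e.symm j
      · subst hi; simp
      · have hij : e i ≠ j := fun h' => hi (by rw [← h', Equiv.symm_apply_apply])
        rw [update_of_ne hi, update_of_ne hij]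
    show F (fun i => update ρ' j (-ρ' j) (e i), z) = F (fun i => ρ' (e i), z)
    rw [hfun, h]
  obtain ⟨U', hU', hU'F, -⟩ := exists_contDiff_comp_sq_of_forall_even F' hF' heven'
  have key : ∀ (ρ : ι → ℝ) (z : P), F (ρ, z) = U' (fun j => ρ (e.symm j) ^ 2, z) := by
    intro ρ z
    have h := hU'F (fun j => ρ (e.symm j)) z
    simpa only [F', Equiv.symm_apply_apply] using h
  refine ⟨fun p => U' (fun j => p.1 (e.symm j), p.2), ?_, key, fun s z hs => ?_⟩
  · exact hU'.comp ((contDiff_pi.2 fun j => (contDiff_apply ℝ ℝ (e.symm j)).comp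
      contDiff_fst).prodMk contDiff_snd)
  · rw [key]
    show U' (fun j => s (e.symm j), z) = U' (fun j => Real.sqrt (s (e.symm j)) ^ 2, z)
    congr 2
    funext j
    exact (Real.sq_sqrt (hs (e.symm j))).symm

/-! ### Local form: `F` smooth and even only on a neighbourhood of `(0, z₀)` -/

/-- The even smooth plateau `η_r (t) = smoothTransition (2 − 4t²/r²)` is even (plumbing for the
local form). [folklore] -/
private theorem evenPlateau_neg (r t : ℝ) :
    Real.smoothTransition (2 - 4 * (-t) ^ 2 / r ^ 2) = Real.smoothTransition (2 - 4 * t ^ 2 / r ^ 2) := by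
  rw [neg_sq]

/-- The even plateau is smooth. [folklore] -/
private theorem contDiff_evenPlateau (r : ℝ) :
    ContDiff ℝ ∞ fun t : ℝ => Real.smoothTransition (2 - 4 * t ^ 2 / r ^ 2) :=
  Real.smoothTransition.contDiff.comp (by fun_prop)

/-- The even plateau is `1` on `|t| ≤ r/2`. [folklore] -/
private theorem evenPlateau_eq_one {r t : ℝ} (hr : 0 < r) (ht : |t| ≤ r / 2) :
    Real.smoothTransition (2 - 4 * t ^ 2 / r ^ 2) = 1 := by
  refine Real.smoothTransition.one_of_one_le ?_
  have h1 : t ^ 2 ≤ (r / 2) ^ 2 := by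
    rw [← sq_abs t]; exact pow_le_pow_left₀ (abs_nonneg t) ht 2
  have hr2 : 0 < r ^ 2 := by positivity
  have h2 : 4 * t ^ 2 / r ^ 2 ≤ 1 := by rw [div_le_one hr2]; nlinarith
  linarith

/-- The even plateau vanishes for `t² ≥ r²/2`. [folklore] -/
private theorem evenPlateau_eq_zero {r t : ℝ} (hr : 0 < r) (ht : r ^ 2 / 2 ≤ t ^ 2) :
    Real.smoothTransition (2 - 4 * t ^ 2 / r ^ 2) = 0 := by
  refine Real.smoothTransition.zero_of_nonpos ?_
  have hr2 : 0 < r ^ 2 := by positivity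
  rw [sub_nonpos, le_div_iff₀ hr2]
  linarith

/-- Where the even plateau is non-zero, `|t| < r`. [folklore] -/
private theorem abs_lt_of_evenPlateau_ne_zero {r t : ℝ} (hr : 0 < r)
    (h : Real.smoothTransition (2 - 4 * t ^ 2 / r ^ 2) ≠ 0) : |t| < r := by
  by_contra hle
  rw [not_lt] at hle
  refine h (evenPlateau_eq_zero hr ?_)
  have : r ^ 2 ≤ t ^ 2 := by
    rw [← sq_abs t]; exact pow_le_pow_left₀ hr.le hle 2
  linarith [sq_nonneg r]

/-- **Whitney's theorem on even functions — local form.** If `F` is `C^∞` on an open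
`V ∋ (0, z₀)` and even in each real variable between points of `V`, then near `(0, z₀)` it is
`U (ρ₁², …, ρ_k², z)` with `U` smooth on the whole space (even plateau cut-off, then the global
theorem); on the small closed orthant `U (s, z) = F (√s, z)`. [folklore] [cite: Seeley1964, Theorem] -/
theorem exists_contDiff_comp_sq_of_forall_even_of_isOpen {k : ℕ} {V : Set ((Fin k → ℝ) × P)}
    (hV : IsOpen V) {z₀ : P} (h0 : ((0 : Fin k → ℝ), z₀) ∈ V) (F : (Fin k → ℝ) × P → E)
    (hF : ContDiffOn ℝ ∞ F V)
    (heven : ∀ (i : Fin k) (ρ : Fin k → ℝ) (z : P), (ρ, z) ∈ V →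
      (update ρ i (-ρ i), z) ∈ V → F (update ρ i (-ρ i), z) = F (ρ, z)) :
    ∃ (U : (Fin k → ℝ) × P → E) (r : ℝ), 0 < r ∧ ContDiff ℝ ∞ U ∧
      (∀ (ρ : Fin k → ℝ) (z : P), (∀ i, |ρ i| ≤ r) → dist z z₀ ≤ r →
        F (ρ, z) = U (fun i => ρ i ^ 2, z)) ∧
      ∀ (s : Fin k → ℝ) (z : P), (∀ i, 0 ≤ s i ∧ s i ≤ r ^ 2) → dist z z₀ ≤ r →
        U (s, z) = F (fun i => Real.sqrt (s i), z) := by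
  -- a symmetric open box `O ⊆ V` around `(0, z₀)`
  obtain ⟨ε, hε, hball⟩ := Metric.isOpen_iff.1 hV _ h0
  have hO : ∀ (ρ : Fin k → ℝ) (z : P), (∀ i, |ρ i| < ε) → dist z z₀ < ε → (ρ, z) ∈ V := by
    intro ρ z hρ hz
    apply hball
    rw [Metric.mem_ball, Prod.dist_eq, max_lt_iff]
    refine ⟨?_, hz⟩
    rw [dist_zero_right]
    rcases Nat.eq_zero_or_pos k with hk | hk
    · subst hk
      rw [Subsingleton.elim ρ 0, norm_zero]; exact hε
    · haveI : Nonempty (Fin k) := ⟨⟨0, hk⟩⟩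
      show ‖ρ‖ < ε
      exact (pi_norm_lt_iff hε).2 fun i => by rw [Real.norm_eq_abs]; exact hρ i
  -- the even cut-off `χ (ρ, z) = (∏ η (ρ i)) • β z`
  let β : ContDiffBump z₀ := ⟨ε / 2, 3 * ε / 4, by positivity, by linarith⟩
  let η : ℝ → ℝ := fun t => Real.smoothTransition (2 - 4 * t ^ 2 / ε ^ 2)
  let χ : (Fin k → ℝ) × P → ℝ := fun p => (∏ i, η (p.1 i)) * β p.2
  have hχ : ContDiff ℝ ∞ χ := by
    refine ContDiff.mul (contDiff_prod fun i _ => ?_) (β.contDiff.comp contDiff_snd)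
    exact (contDiff_evenPlateau ε).comp ((contDiff_apply ℝ ℝ i).comp contDiff_fst)
  have hχeven : ∀ (i : Fin k) (ρ : Fin k → ℝ) (z : P), χ (update ρ i (-ρ i), z) = χ (ρ, z) := by
    intro i ρ z
    simp only [χ]
    congr 1
    refine Finset.prod_congr rfl fun j _ => ?_
    rcases eq_or_ne j i with rfl | hj
    · rw [update_self]; exact evenPlateau_neg ε (ρ j)
    · rw [update_of_ne hj]
  have hχsupp : ∀ (ρ : Fin k → ℝ) (z : P), χ (ρ, z) ≠ 0 → (∀ i, |ρ i| < ε) ∧ dist z z₀ < ε := by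
    intro ρ z h
    have hb : β z ≠ 0 := fun hb => h (by simp only [χ, hb, mul_zero])
    have hp : ∀ i, η (ρ i) ≠ 0 := fun i hi =>
      h (by simp only [χ]; rw [Finset.prod_eq_zero (Finset.mem_univ i) hi, zero_mul])
    refine ⟨fun i => abs_lt_of_evenPlateau_ne_zero hε (hp i), ?_⟩
    by_contra hz
    exact hb (β.zero_of_le_dist (by simp only [β]; linarith [not_lt.1 hz]))
  have hχone : ∀ (ρ : Fin k → ℝ) (z : P), (∀ i, |ρ i| ≤ ε / 2) → dist z z₀ ≤ ε / 2 → χ (ρ, z) = 1 := by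
    intro ρ z hρ hz
    simp only [χ]
    rw [Finset.prod_eq_one fun i _ => evenPlateau_eq_one hε (hρ i), one_mul]
    exact β.one_of_mem_closedBall (by simpa [β, Metric.mem_closedBall] using hz)
  -- the cut-off function is smooth and even on the whole space
  let Ft : (Fin k → ℝ) × P → E := fun p => χ p • F p
  have hFt : ContDiff ℝ ∞ Ft := by
    refine contDiff_iff_contDiffAt.2 fun p => ?_
    by_cases hp : (∀ i, |p.1 i| < ε) ∧ dist p.2 z₀ < ε
    · have hpV : V ∈ 𝓝 p := hV.mem_nhds (hO p.1 p.2 hp.1 hp.2)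
      exact hχ.contDiffAt.smul (hF.contDiffAt hpV)
    · -- off the open box `χ` vanishes identically near `p`
      have hzero : ∀ᶠ q in 𝓝 p, Ft q = 0 := by
        rcases not_and_or.1 hp with h1 | h2
        · obtain ⟨i, hi⟩ := not_forall.1 h1
          have hi' : ε ≤ |p.1 i| := not_lt.1 hi
          have hopen : ∀ᶠ q : (Fin k → ℝ) × P in 𝓝 p, ε / Real.sqrt 2 < |q.1 i| := by
            have hc : Continuous fun q : (Fin k → ℝ) × P => |q.1 i| := by fun_prop
            refine hc.continuousAt.eventually (lt_mem_nhds ?_)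
            calc ε / Real.sqrt 2 < ε :=
                  div_lt_self hε (by rw [Real.lt_sqrt (by norm_num)]; norm_num)
              _ ≤ |p.1 i| := hi'
          filter_upwards [hopen] with q hq
          have hq2 : ε ^ 2 / 2 ≤ q.1 i ^ 2 := by
            have hs : (ε / Real.sqrt 2) ^ 2 = ε ^ 2 / 2 := by
              rw [div_pow, Real.sq_sqrt (by norm_num)]
            rw [← hs, ← sq_abs (q.1 i)]
            exact pow_le_pow_left₀ (by positivity) hq.le 2
          simp only [Ft, χ]
          rw [Finset.prod_eq_zero (Finset.mem_univ i) (evenPlateau_eq_zero hε hq2 : η (q.1 i) = 0),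
            zero_mul, zero_smul]
        · have h2' : ε ≤ dist p.2 z₀ := not_lt.1 h2
          have hopen : ∀ᶠ q : (Fin k → ℝ) × P in 𝓝 p, 3 * ε / 4 < dist q.2 z₀ := by
            have hc : Continuous fun q : (Fin k → ℝ) × P => dist q.2 z₀ := by fun_prop
            exact hc.continuousAt.eventually (lt_mem_nhds (by linarith))
          filter_upwards [hopen] with q hq
          simp only [Ft, χ]
          rw [β.zero_of_le_dist (by simp only [β]; exact hq.le), mul_zero, zero_smul]
      exact (contDiffAt_const (c := (0 : E))).congr_of_eventuallyEq hzero
  have hFteven : ∀ (i : Fin k) (ρ : Fin k → ℝ) (z : P), Ft (update ρ i (-ρ i), z) = Ft (ρ, z) := by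
    intro i ρ z
    simp only [Ft, hχeven]
    by_cases hz : χ (ρ, z) = 0
    · rw [hz, zero_smul, zero_smul]
    · obtain ⟨hρ, hd⟩ := hχsupp ρ z hz
      have hρ' : ∀ j, |update ρ i (-ρ i) j| < ε := fun j => by
        rcases eq_or_ne j i with rfl | hj
        · rw [update_self, abs_neg]; exact hρ j
        · rw [update_of_ne hj]; exact hρ j
      rw [heven i ρ z (hO ρ z hρ hd) (hO _ z hρ' hd)]
  -- the global theorem for the cut-off function
  obtain ⟨U, hU, hUF, -⟩ := exists_contDiff_comp_sq_of_forall_even Ft hFt hFteven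
  have key : ∀ (ρ : Fin k → ℝ) (z : P), (∀ i, |ρ i| ≤ ε / 2) → dist z z₀ ≤ ε / 2 →
      F (ρ, z) = U (fun i => ρ i ^ 2, z) := by
    intro ρ z hρ hz
    rw [← hUF, show Ft (ρ, z) = χ (ρ, z) • F (ρ, z) from rfl, hχone ρ z hρ hz, one_smul]
  refine ⟨U, ε / 2, by positivity, hU, key, fun s z hs hz => ?_⟩
  rw [key (fun i => Real.sqrt (s i)) z (fun i => ?_) hz]
  · congr 2
    funext i
    exact (Real.sq_sqrt (hs i).1).symm
  · rw [abs_of_nonneg (Real.sqrt_nonneg _), Real.sqrt_le_left (by positivity)]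
    exact (hs i).2

end Several

end Literature.Analysis.Calculus

end
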